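import Summits.Ventures.HSemireg.GolyshevLuntsOrlovLagrangianFrame
import Summits.Ventures.HSemireg.GolyshevLuntsOrlovTransversality
import HarnessLib

/-!
# Golyshev–Lunts–Orlov, proof of Prop. 9.6.1 (p. 30 L25–41): the whole criterion chain as ONE theorem —
# «`Q_ℝ(I_{ω_A}J_{A×Â}(·), ·)` nondegenerate on `Λ_{2,ℝ}`» ⟺ «`J_{A×Â}W ∩ W = 0` (∗)»

Venture cell `pub-hsemireg`, literature seat `lit-w-polishchuk-orlov` (g14, 2026-08-25). This leaf is the JOIN of
`GolyshevLuntsOrlovLagrangianFrame.lean` (first link `nondegenerateOn_iff_map_inf_eq_bot` = Lemma 9.4.1 2) ⟺ 3),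
and the `I_{ω_A}`-factor lemma `nondegenerateOn_comp_iff`) with `GolyshevLuntsOrlovTransversality.lean` (second
link `map_inf_eq_bot_iff`), both imported; it adds only the instantiation at `(V ⊕ V*, Q_ℝ, Λ_{2,ℝ}, J_{A×Â})`.

PRINTED ([GolyshevLuntsOrlov2001MirrorAV], arXiv math/9812003v2 p. 30 L25–41, text layer
`widen/LIT-W/texts-po/glo01v2/p0030.num.txt`): «By Lemma 9.4.1 in order for `ω_E` to exist the symmetric bilinear
form `Q_ℝ(I_{ω_A}J_{A×Â}(·), ·)` must be nondegenerate on `Λ_{2,ℝ}`. This is equivalent to the statement that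
`J_{A×Â}Λ_{2,ℝ} ∩ Λ_{2,ℝ} = 0`. Put `W := ⊕ℝe₋ᵢ`. Then since `J_{A×Â}` preserves the form `Q_ℝ` the last equality is
equivalent to `J_{A×Â}W ∩ W = 0`. (∗)»; the factor `I_{ω_A}` preserves `Q_ℝ` (p. 27 L107, `I_{ω_A} ∈ U_{A,ℚ}(ℝ) ⊂
SO(V_A ⊕ V_Â, Q_{A,ℝ})`, 9.1) and `Λ_{2,ℝ}` (p. 30 L3–6: «This operator preserves each subspace `Γ_{iℝ}`, `Γ*_{iℝ}`. In
particular it preserves `Λ_{1,ℝ}`, `Λ_{2,ℝ}`»).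

MODEL (as in the two imported leaves): `K` a field (print `ℝ`); `V = V_A`, `finrank K V = 2n`; `V* = Module.Dual K V`;
`Q` = ANY bilinear form on `V × V*` with `Q(p, q) = p.2(q.1) + q.2(p.1)` (3.1 — such a `Q` exists:
`exists_pairingForm`; it is nondegenerate: `pairing_nondegenerate`); `J_{A×Â} = J.prodMap (−J.dualMap)` (1.2);
`Λ_{2,ℝ} = W.prod W.dualAnnihilator`; `I` = ANY linear `I : V × V* → V × V*` preserving `Q` and mapping `Λ_{2,ℝ}`
onto itself (printed: `I = I_{ω_A}`; its block form is in `GolyshevLuntsOrlovIomega.lean`, not imported).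

## Results (PROVED; theorems only — no definition, no named fact, no `sorry`)
* `exists_pairingForm`, `pairing_nondegenerate`, `finrank_prod_dual` (`dim(V ⊕ V*) = 2 dim V`).
* **`nondegenerateOn_iff_transversal`**: under `dim V = 2n`, `dim W = n`, `J² = −1` and the three hypotheses on
  `I`: «`Q(I(J_{A×Â}·), ·)` restricted to `Λ_{2,ℝ}` is non-degenerate» ⟺ «`JW ∩ W = 0`» — the printed chain end to
  end, as the composite of the three imported links.
* `example_inhabited`: all hypotheses are inhabited (`K = ℚ`, `V = ℚ²`, `J(a, b) = (−b, a)`, `W = ℚ·(1, 0)`,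
  `I = id`, `n = 1`).

HONEST FRAMING: linear algebra only; `I_{ω_A}` itself, lattices ∕ tori, Lemma 9.4.4 and the Zariski-density step
after (∗) are NOT formalised; nothing here constructs a mirror pair or an abelian variety, or says HC holds.
-/

namespace Summit.Ventures.HSemireg.GolyshevLuntsOrlovTransversalityChain

open Module Submodule

variable {K : Type*} [Field K] {V : Type*} [AddCommGroup V] [Module K V]

/-- The canonical symmetric form `Q((a₁, b₁), (a₂, b₂)) = b₁(a₂) + b₂(a₁)` of 3.1 exists as a bilinear form on
`V × V*`. -/
theorem exists_pairingForm :
    ∃ Q : LinearMap.BilinForm K (V × Dual K V), ∀ p q, Q p q = p.2 q.1 + q.2 p.1 :=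
  ⟨LinearMap.mk₂ K (fun p q => p.2 q.1 + q.2 p.1)
      (fun p p' q => by simp only [Prod.snd_add, Prod.fst_add, LinearMap.add_apply, map_add]; abel)
      (fun c p q => by simp only [Prod.smul_snd, Prod.smul_fst, LinearMap.smul_apply, map_smul, smul_eq_mul]; ring)
      (fun p q q' => by simp only [Prod.snd_add, Prod.fst_add, LinearMap.add_apply, map_add]; abel)
      (fun c p q => by simp only [Prod.smul_snd, Prod.smul_fst, LinearMap.smul_apply, map_smul, smul_eq_mul]; ring),
    fun _ _ => rfl⟩

/-- `Q` is nondegenerate on `V ⊕ V*` (finite dimension: the dual separates points). -/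
theorem pairing_nondegenerate [FiniteDimensional K V] (Q : LinearMap.BilinForm K (V × Dual K V))
    (hQ : ∀ p q, Q p q = p.2 q.1 + q.2 p.1) (x : V × Dual K V) (hx : x ≠ 0) : ∃ y, Q x y ≠ 0 := by
  by_cases h2 : x.2 = 0
  · have h1 : x.1 ≠ 0 := fun h1 => hx (Prod.ext h1 h2)
    obtain ⟨g, hg⟩ : ∃ g : Dual K V, g x.1 ≠ 0 := by
      by_contra hno
      exact h1 ((Module.forall_dual_apply_eq_zero_iff K x.1).mp fun g =>
        Classical.byContradiction fun hg => hno ⟨g, hg⟩)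
    exact ⟨(0, g), by rw [hQ, h2, LinearMap.zero_apply, zero_add]; exact hg⟩
  · obtain ⟨u, hu⟩ : ∃ u : V, x.2 u ≠ 0 := by
      by_contra hno
      exact h2 (LinearMap.ext fun u => Classical.byContradiction fun hu => hno ⟨u, hu⟩)
    exact ⟨(u, 0), by rw [hQ, LinearMap.zero_apply, add_zero]; exact hu⟩

/-- `dim (V ⊕ V*) = 2 dim V`. -/
theorem finrank_prod_dual [FiniteDimensional K V] : finrank K (V × Dual K V) = 2 * finrank K V := by
  rw [Module.finrank_prod, Subspace.dual_finrank_eq, two_mul]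

/-- **The printed chain, end to end** [cite: GolyshevLuntsOrlov2001MirrorAV, proof of Prop. 9.6.1, arXiv v2 p. 30
L25–41]: for `dim V = 2n`, `dim W = n`, `J² = −1`, `Q` the pairing form, `Λ_{2,ℝ} = W ⊕ W^∘`,
`J_{A×Â} = J ⊕ Ĵ` and any `Q`-isometry `I` mapping `Λ_{2,ℝ}` onto itself:
«`Q(I(J_{A×Â}·), ·)|_{Λ_{2,ℝ}}` non-degenerate» ⟺ «`JW ∩ W = 0`». Composite of the imported
`GolyshevLuntsOrlovLagrangian.nondegenerateOn_comp_iff`, `….nondegenerateOn_iff_map_inf_eq_bot` and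
`GolyshevLuntsOrlovTransversality.map_inf_eq_bot_iff`. «Non-degenerate on `Λ_{2,ℝ}`» is read as: the LEFT radical
of the restriction is zero; in print the form `Q_ℝ(c·, ·)`, `c = J_{A×Â}I_{ω_A}`, is SYMMETRIC (9.4, p. 27 L107–109:
«They commute and preserve the bilinear form `Q_{A,ℝ}` … `c` preserves the bilinear form `Q_{A,ℝ}` and `c² = 1`. Hence,
the bilinear form `Q_{A,ℝ}(c(·), ·)` is symmetric»), so for the printed instance left and right radicals agree. -/
theorem nondegenerateOn_iff_transversal [FiniteDimensional K V] (Q : LinearMap.BilinForm K (V × Dual K V))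
    (hQ : ∀ p q, Q p q = p.2 q.1 + q.2 p.1) (J : V →ₗ[K] V) (hJ : ∀ x, J (J x) = -x) (W : Submodule K V)
    {n : ℕ} (hdim : finrank K V = 2 * n) (hWn : finrank K W = n) (I : (V × Dual K V) →ₗ[K] (V × Dual K V))
    (hI : ∀ u v, Q (I u) (I v) = Q u v) (hIΛ : ∀ p ∈ W.prod W.dualAnnihilator, I p ∈ W.prod W.dualAnnihilator)
    (hIΛ' : ∀ p ∈ W.prod W.dualAnnihilator, ∃ p₀ ∈ W.prod W.dualAnnihilator, I p₀ = p) :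
    (∀ p ∈ W.prod W.dualAnnihilator,
        (∀ q ∈ W.prod W.dualAnnihilator, Q (I (J.prodMap (-J.dualMap) p)) q = 0) → p = 0) ↔
      W.map J ⊓ W = ⊥ := by
  have hJ2 : ∀ p, J.prodMap (-J.dualMap) (J.prodMap (-J.dualMap) p) = -p :=
    GolyshevLuntsOrlovTransversality.prodMap_sq J hJ
  have hiso : ∀ p ∈ W.prod W.dualAnnihilator, ∀ q ∈ W.prod W.dualAnnihilator, Q p q = 0 := fun p hp q hq => by
    rw [hQ]; exact GolyshevLuntsOrlovTransversality.prod_dualAnnihilator_isotropic W p q hp hq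
  have hdim' : finrank K (V × Dual K V) = 2 * finrank K V := finrank_prod_dual
  have hΛ : finrank K (W.prod W.dualAnnihilator) = finrank K V :=
    GolyshevLuntsOrlovTransversality.finrank_prod_dualAnnihilator W
  rw [GolyshevLuntsOrlovLagrangian.nondegenerateOn_comp_iff Q (J.prodMap (-J.dualMap)) I hI _ hIΛ hIΛ',
    GolyshevLuntsOrlovLagrangian.nondegenerateOn_iff_map_inf_eq_bot Q (J.prodMap (-J.dualMap))
      (pairing_nondegenerate Q hQ) hJ2 _ hiso hdim' hΛ]
  exact GolyshevLuntsOrlovTransversality.map_inf_eq_bot_iff J hJ W hdim hWn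

/-- Non-vacuity: every hypothesis of `nondegenerateOn_iff_transversal` is inhabited (`K = ℚ`, `V = ℚ × ℚ`,
`J(a, b) = (−b, a)`, `W = ℚ·(1, 0)`, `n = 1`, `I = id`), and there (∗) holds. -/
theorem example_inhabited :
    ∃ (Q : LinearMap.BilinForm ℚ ((ℚ × ℚ) × Dual ℚ (ℚ × ℚ))) (J : (ℚ × ℚ) →ₗ[ℚ] (ℚ × ℚ))
      (W : Submodule ℚ (ℚ × ℚ)) (I : ((ℚ × ℚ) × Dual ℚ (ℚ × ℚ)) →ₗ[ℚ] ((ℚ × ℚ) × Dual ℚ (ℚ × ℚ))),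
      (∀ p q, Q p q = p.2 q.1 + q.2 p.1) ∧ (∀ x, J (J x) = -x) ∧ finrank ℚ (ℚ × ℚ) = 2 * 1 ∧
      finrank ℚ W = 1 ∧ (∀ u v, Q (I u) (I v) = Q u v) ∧
      (∀ p ∈ W.prod W.dualAnnihilator, I p ∈ W.prod W.dualAnnihilator) ∧
      (∀ p ∈ W.prod W.dualAnnihilator, ∃ p₀ ∈ W.prod W.dualAnnihilator, I p₀ = p) ∧ W.map J ⊓ W = ⊥ := by
  obtain ⟨Q, hQ⟩ := exists_pairingForm (K := ℚ) (V := ℚ × ℚ)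
  obtain ⟨J, W, hJ, hdim, hWn, hJW⟩ := GolyshevLuntsOrlovTransversality.example_plane
  exact ⟨Q, J, W, LinearMap.id, hQ, hJ, hdim, hWn, fun _ _ => rfl, fun p hp => hp,
    fun p hp => ⟨p, hp, rfl⟩, hJW⟩

end Summit.Ventures.HSemireg.GolyshevLuntsOrlovTransversalityChain
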